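import Mathlib
import Summits.ValiantsHypothesis.ValiantsHypothesis.Theses.LacunarySymmetroid

/-!
# `MatrixDescartes` — line «profile» (val-idea-6 g4, LINE 2; lens «control» + «assume the law fails»;
# «Σ as additive combinatorics» with teeth)

LINE (D-0145) on crux `Summit.ValiantsHypothesis.ValiantsHypothesis.Theses.LacunarySymmetroid.MatrixDescartes`
(stmt-ValiantsHypothesis-18050), census / Conjecture-B side through the FULL (stamp) formats; companion of line «range»
(`Lines/range.lean`), whose count law is the `ℓ¹`-shadow of the law proved here.  rc 0, **zero sorries**.

## Control quantity
The coefficient PROFILE `r ↦ |a_r(det P)|` against the binomial profile, and the exponent design's ordered `m`-fold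
REPRESENTATION FUNCTION `R_d^{(m)}(r) = #{λ : [m] → [K] : Σ d_{λ(i)} = r} = [t^r](Σ_l t^{d_l})^m` (`Rrep`).
* ROOT SIDE (`profileLaw_fullPos`, PROVED, sharp at `c(X−1)^n`): `natDegree` distinct positive roots ⇒ for all `r ≤ n`
  `|a_r · a_{n−r}| ≥ C(n,r)² · |a_0 · a_n|` — the endpoint case of Newton–Maclaurin, proved here in three lines of
  Cauchy–Schwarz on the pairs `(T, S∖T)` of `r`-subsets of the root set (`choose_sq_mul_prod_le`).
* HEIGHT SIDE (`abs_coeff_det_pencil_le`, PROVED, any `m`): letters `≤ h` ⇒ `|a_r(det P)| ≤ m!·h^m·R_d^{(m)}(r)`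
  (permutation expansion; the design enters through its representation numbers).
* PROFILE LAW (`pencilProfileLaw`): full pencil ⇒ `C(n,r)²·|c₀·lc| ≤ (m! h^m)²·R(r)·R(n−r)` for every `r ≤ n`.
  Summing `R` over `r` (`= K^m`) returns «range»; on THIN designs it is `K`-FREE (`profileLaw_thin`): a Sidon /
  `B_m[g]` design carries only `n ≲ 2·log₂(m!·h^m·g)` full roots however many letters it has.

## What it decides (PROVED)  — INSTRUMENT rows for the census's extremal stamp bases (`m = 2`, integer-normalised ends)
`profileRow_dA5 … dA8b`: a full pencil of the stamp degree on the basis needs a letter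
`≥ 54 (dA5, n=16) · 205 (dA6, 20) · 1848 (dA7a, 26) · 1390 (dA7b, dA7c, 26) · 12259 (dA8a, 32) · 10857 (dA8b, 32)`,
versus the design-blind «range» rows `31 / 104 / 725 / 725 / 5149 / 5149` — the thin windows (`R = 1, 2`) of the
extremal bases are where the law bites (val-sym-engine-7 STAMP-G6G8: lattice searches on these bases below these
heights are provably empty; the binding window `(r, R(r), R(n−r))` is named in each docstring).
`design_rich_of_full` («assume the law fails»): a long full format at bounded height forces the design to be ADDITIVELY
RICH on the whole binomial window, `max(R(r),R(n−r)) ≥ C(n,r)/(m! h^m)` for all `r` — violators live on high-energy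
(AP-like) designs, which are exactly the designs whose pencils have LOW degree (`deg ≤ m·max d`); thin (Sidon-like)
designs, which have the large degrees, cannot carry them.  This is the structure a super-polynomial full family would
need at constant-free height, and it is self-limiting; what VNP-hardness would need is therefore (again) unbounded height
or the non-full sector (`HeightMDRNonFull` of «range»).

## Honest framing
Everything here is on the FULL sector and height-sensitive: it does not close `MatrixDescartes` (height-free), does not
touch Conjecture B at `m = 2` beyond pricing its integer certificates, and VP ≠ VNP is not moved.  No new open
obligation is typed: the line's open target is «range»'s `HeightMDRNonFull` / the crux itself; its own content is the
proved law + the seven rows + the additive-structure reading.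

## Why novel (problem-relative)
«range» (this seat, LINE 1) is design-blind; `conditioning` (val-idea-1, 19561) prices octaves by letter condition;
«finite/stamp» (g3) use the design only through COVERAGE (`2E ⊇ [0,n]`, postage-stamp numbers).  Here the design's
REPRESENTATION FUNCTION enters the root count — coverage says `R ≥ 1` on `[0,n]`, the profile law says `R` must be
binomially LARGE — the first quantitative bridge between the census's additive bases and letter height.  Literature:
Newton–Maclaurin inequalities (Hardy–Littlewood–Pólya §2.22) for the root side; `B_h[g]` sets / representation functions
(Halberstam–Roth, Sequences ch. II; Erdős–Turán 1941 on Sidon sets) for the design side; bounded-height real-root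
counts (Borwein–Erdélyi–Kós 1999 doi:10.1112/s0024611599011831).  No prior statement joining them on pencils found.

## Cheapest falsifier
A reported integer full pencil on `dA7a` of degree 26 with all entries `≤ 1847` (contradicts `profileRow_dA7a` ⇒
instrument bug).  Calibration: at `det P = c(t−1)^n` both sides of the root-side law are equal, so near-extremal
candidates again have roots clustered at `1`.
-/

set_option linter.dupNamespace false

noncomputable section

namespace Summit.ValiantsHypothesis.ValiantsHypothesis.Theses.LacunarySymmetroid.ProfileLine

open scoped BigOperators Matrix
open Polynomial Finset

/-! ## §0 Defs (verbatim from lines «stamp» / «range»; workfiles are not importable) -/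

abbrev pencil {m K : ℕ} (d : Fin K → ℕ) (S : Fin K → Matrix (Fin m) (Fin m) ℝ) :
    Matrix (Fin m) (Fin m) ℝ[X] :=
  ∑ l, ((Polynomial.X : ℝ[X]) ^ d l) • (S l).map Polynomial.C

def IsFullPosRooted (p : ℝ[X]) : Prop := (p.roots.filter (0 < ·)).toFinset.card = p.natDegree

/-- Ordered `m`-fold REPRESENTATION NUMBER of `r` by the exponent design `d`:
`R_d^{(m)}(r) = #{λ : Fin m → Fin K | Σ_i d(λ i) = r} = [t^r] (Σ_l t^{d_l})^m`. -/
def Rrep {K : ℕ} (d : Fin K → ℕ) (m r : ℕ) : ℕ :=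
  (Finset.univ.filter (fun lam : Fin m → Fin K => (∑ i, d (lam i)) = r)).card

/-! ## §1 Root bookkeeping (as in «range») -/

theorem card_roots_of_fullPos {q : ℝ[X]} (h : IsFullPosRooted q) :
    Multiset.card q.roots = q.natDegree := by
  unfold IsFullPosRooted at h
  have h1 : (q.roots.filter (0 < ·)).toFinset.card ≤ Multiset.card (q.roots.filter (0 < ·)) :=
    Multiset.toFinset_card_le _
  have h2 : Multiset.card (q.roots.filter (0 < ·)) ≤ Multiset.card q.roots :=
    Multiset.card_le_card (Multiset.filter_le _ _)
  have h3 : Multiset.card q.roots ≤ q.natDegree := Polynomial.card_roots' q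
  omega

theorem filter_roots_of_fullPos {q : ℝ[X]} (h : IsFullPosRooted q) :
    q.roots.filter (0 < ·) = q.roots := by
  have hc := card_roots_of_fullPos h
  unfold IsFullPosRooted at h
  have h1 : (q.roots.filter (0 < ·)).toFinset.card ≤ Multiset.card (q.roots.filter (0 < ·)) :=
    Multiset.toFinset_card_le _
  exact Multiset.eq_of_le_of_card_le (Multiset.filter_le _ _) (by omega)

theorem roots_pos_of_fullPos {q : ℝ[X]} (h : IsFullPosRooted q) : ∀ a ∈ q.roots, 0 < a :=
  Multiset.filter_eq_self.1 (filter_roots_of_fullPos h)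

theorem toFinset_card_roots_of_fullPos {q : ℝ[X]} (h : IsFullPosRooted q) :
    q.roots.toFinset.card = q.natDegree := by
  have h' := h
  unfold IsFullPosRooted at h'
  rw [filter_roots_of_fullPos h] at h'
  exact h'

theorem roots_eq_toFinset_val_of_fullPos {q : ℝ[X]} (h : IsFullPosRooted q) :
    q.roots = q.roots.toFinset.val := by
  have hnd : q.roots.Nodup := by
    rw [← Multiset.toFinset_card_eq_card_iff_nodup, toFinset_card_roots_of_fullPos h, card_roots_of_fullPos h]
  rw [Multiset.toFinset_val, Multiset.dedup_eq_self.2 hnd]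

/-! ## §2 Symmetric Maclaurin by Cauchy–Schwarz (PROVED): `e_r(S) · e_{n−r}(S) ≥ C(n,r)² · ∏ S` -/

/-- For a finite set `S` of positive reals with `|S| = n` and `r ≤ n`:
`C(n,r)² · ∏_{a∈S} a ≤ (Σ_{|T|=r} ∏_T a) · (Σ_{|U|=n−r} ∏_U a)`.  Cauchy–Schwarz on the pairs `(T, S∖T)`, each of
product `∏ S`. [folklore: the endpoint case of Newton–Maclaurin] -/
theorem choose_sq_mul_prod_le (S : Finset ℝ) (hS : ∀ a ∈ S, 0 < a) {r : ℕ} (hr : r ≤ S.card) :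
    ((S.card.choose r : ℕ) : ℝ) ^ 2 * ∏ a ∈ S, a
      ≤ (∑ T ∈ S.powersetCard r, ∏ a ∈ T, a) * (∑ U ∈ S.powersetCard (S.card - r), ∏ a ∈ U, a) := by
  have hP : 0 < ∏ a ∈ S, a := Finset.prod_pos hS
  -- re-index the second factor by complements
  have hre : (∑ U ∈ S.powersetCard (S.card - r), ∏ a ∈ U, a)
      = ∑ T ∈ S.powersetCard r, ∏ a ∈ S \ T, a := by
    refine (Finset.sum_bij' (fun U _ => S \ U) (fun T _ => S \ T) ?_ ?_ ?_ ?_ ?_).symm <;> try skip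
    · intro U hU
      rw [Finset.mem_powersetCard] at hU ⊢
      refine ⟨Finset.sdiff_subset, ?_⟩
      rw [Finset.card_sdiff_of_subset hU.1]; omega
    · intro T hT
      rw [Finset.mem_powersetCard] at hT ⊢
      refine ⟨Finset.sdiff_subset, ?_⟩
      rw [Finset.card_sdiff_of_subset hT.1]; omega
    · intro U hU
      rw [Finset.mem_powersetCard] at hU
      exact Finset.sdiff_sdiff_eq_self hU.1
    · intro T hT
      rw [Finset.mem_powersetCard] at hT
      exact Finset.sdiff_sdiff_eq_self hT.1
    · intro U hU
      rfl
  rw [hre]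
  have hcs := Finset.sum_sq_le_sum_mul_sum_of_sq_le_mul (S.powersetCard r)
    (r := fun _ => Real.sqrt (∏ a ∈ S, a)) (f := fun T => ∏ a ∈ T, a) (g := fun T => ∏ a ∈ S \ T, a)
    (fun T hT => Finset.prod_nonneg (fun a ha => (hS a ((Finset.mem_powersetCard.1 hT).1 ha)).le))
    (fun T _ => Finset.prod_nonneg (fun a ha => (hS a (Finset.sdiff_subset ha)).le))
    (fun T hT => by
      rw [Real.sq_sqrt hP.le, mul_comm, Finset.prod_sdiff (Finset.mem_powersetCard.1 hT).1])
  rw [Finset.sum_const, Finset.card_powersetCard, nsmul_eq_mul, mul_pow, Real.sq_sqrt hP.le] at hcs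
  exact hcs

/-! ## §3 The SYMMETRIC PROFILE LAW for full-positive-rooted polynomials (PROVED):
`|a_r · a_{n−r}| ≥ C(n,r)² · |a_0 · a_n|` -/

theorem esymm_roots_eq {q : ℝ[X]} (h : IsFullPosRooted q) (j : ℕ) :
    q.roots.esymm j = ∑ T ∈ q.roots.toFinset.powersetCard j, ∏ a ∈ T, a := by
  conv_lhs => rw [roots_eq_toFinset_val_of_fullPos h, ← Multiset.map_id q.roots.toFinset.val]
  rw [Finset.esymm_map_val]
  rfl

theorem abs_coeff_eq {q : ℝ[X]} (h : IsFullPosRooted q) {k : ℕ} (hk : k ≤ q.natDegree) :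
    |q.coeff k| = |q.leadingCoeff| * ∑ T ∈ q.roots.toFinset.powersetCard (q.natDegree - k), ∏ a ∈ T, a := by
  rw [coeff_eq_esymm_roots_of_card (card_roots_of_fullPos h) hk, esymm_roots_eq h, abs_mul, abs_mul,
    abs_pow, abs_neg, abs_one, one_pow, mul_one]
  congr 1
  exact abs_of_nonneg (Finset.sum_nonneg (fun T hT => Finset.prod_nonneg (fun a ha =>
    (roots_pos_of_fullPos h a (Multiset.mem_toFinset.1 ((Finset.mem_powersetCard.1 hT).1 ha))).le)))

/-- **Symmetric profile law.** If `q` has `natDegree q = n` distinct positive roots then for every `r ≤ n`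
`C(n,r)² · |a_0 · a_n| ≤ |a_r · a_{n−r}|` (equality at `c(X−1)^n`). [folklore; Newton–Maclaurin endpoint case] -/
theorem profileLaw_fullPos (q : ℝ[X]) (h : IsFullPosRooted q) {r : ℕ} (hr : r ≤ q.natDegree) :
    ((q.natDegree.choose r : ℕ) : ℝ) ^ 2 * |q.coeff 0 * q.leadingCoeff|
      ≤ |q.coeff r * q.coeff (q.natDegree - r)| := by
  set S := q.roots.toFinset with hSdef
  have hS : ∀ a ∈ S, 0 < a := fun a ha => roots_pos_of_fullPos h a (Multiset.mem_toFinset.1 ha)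
  have hcard : S.card = q.natDegree := toFinset_card_roots_of_fullPos h
  have key := choose_sq_mul_prod_le S hS (r := r) (by rw [hcard]; exact hr)
  rw [hcard] at key
  have h0 : |q.coeff 0| = |q.leadingCoeff| * ∏ a ∈ S, a := by
    rw [abs_coeff_eq h (Nat.zero_le _), Nat.sub_zero, ← hcard, Finset.powersetCard_self, Finset.sum_singleton]
  have hr' : |q.coeff r| = |q.leadingCoeff| * ∑ T ∈ S.powersetCard (q.natDegree - r), ∏ a ∈ T, a :=
    abs_coeff_eq h hr
  have hnr : |q.coeff (q.natDegree - r)|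
      = |q.leadingCoeff| * ∑ T ∈ S.powersetCard r, ∏ a ∈ T, a := by
    rw [abs_coeff_eq h (Nat.sub_le _ _), Nat.sub_sub_self hr]
  have hlc : 0 ≤ |q.leadingCoeff| := abs_nonneg _
  rw [abs_mul, abs_mul, h0, hr', hnr]
  calc ((q.natDegree.choose r : ℕ) : ℝ) ^ 2 * (|q.leadingCoeff| * (∏ a ∈ S, a) * |q.leadingCoeff|)
      = |q.leadingCoeff| * |q.leadingCoeff| * (((q.natDegree.choose r : ℕ) : ℝ) ^ 2 * ∏ a ∈ S, a) := by ring
    _ ≤ |q.leadingCoeff| * |q.leadingCoeff| * ((∑ T ∈ S.powersetCard r, ∏ a ∈ T, a)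
          * (∑ U ∈ S.powersetCard (q.natDegree - r), ∏ a ∈ U, a)) :=
        mul_le_mul_of_nonneg_left key (mul_nonneg hlc hlc)
    _ = _ := by ring

/-! ## §4 Coefficient heights of a pencil determinant see the design's REPRESENTATION NUMBERS (PROVED) -/

theorem pencil_apply {m K : ℕ} (d : Fin K → ℕ) (S : Fin K → Matrix (Fin m) (Fin m) ℝ) (a b : Fin m) :
    pencil d S a b = ∑ l, X ^ d l * C (S l a b) := by
  simp only [pencil, Matrix.sum_apply, Matrix.smul_apply, Matrix.map_apply, smul_eq_mul]

theorem prod_pencil_apply {m K : ℕ} (d : Fin K → ℕ) (S : Fin K → Matrix (Fin m) (Fin m) ℝ)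
    (σ : Equiv.Perm (Fin m)) :
    ∏ i, pencil d S (σ i) i = ∑ lam : Fin m → Fin K, X ^ (∑ i, d (lam i)) * C (∏ i, S (lam i) (σ i) i) := by
  simp_rw [pencil_apply]
  rw [Finset.prod_univ_sum (fun _ => Finset.univ) (fun i l => X ^ d l * C (S l (σ i) i)),
    Fintype.piFinset_univ]
  refine Finset.sum_congr rfl (fun lam _ => ?_)
  rw [Finset.prod_mul_distrib, Finset.prod_pow_eq_pow_sum, ← map_prod C]

theorem coeff_prod_pencil {m K : ℕ} (d : Fin K → ℕ) (S : Fin K → Matrix (Fin m) (Fin m) ℝ)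
    (σ : Equiv.Perm (Fin m)) (r : ℕ) :
    (∏ i, pencil d S (σ i) i).coeff r
      = ∑ lam : Fin m → Fin K, if r = ∑ i, d (lam i) then ∏ i, S (lam i) (σ i) i else 0 := by
  rw [prod_pencil_apply, finsetSum_coeff]
  refine Finset.sum_congr rfl (fun lam _ => ?_)
  rw [X_pow_mul, coeff_C_mul_X_pow]

/-- `|[t^r] det P| ≤ m! · h^m · R_d^{(m)}(r)` for letters bounded by `h`. [folklore: permutation expansion] -/
theorem abs_coeff_det_pencil_le {m K : ℕ} (d : Fin K → ℕ) (S : Fin K → Matrix (Fin m) (Fin m) ℝ) {h : ℝ}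
    (hS : ∀ l i j, |S l i j| ≤ h) (r : ℕ) :
    |(pencil d S).det.coeff r| ≤ (m.factorial : ℝ) * (h ^ m * Rrep d m r) := by
  rw [Matrix.det_apply', finsetSum_coeff]
  have key : ∀ σ : Equiv.Perm (Fin m),
      |((((Equiv.Perm.sign σ : ℤˣ) : ℤ) : ℝ[X]) * ∏ i, pencil d S (σ i) i).coeff r|
        ≤ h ^ m * Rrep d m r := by
    intro σ
    have hsgn : |((((Equiv.Perm.sign σ : ℤˣ) : ℤ) : ℝ[X]) * ∏ i, pencil d S (σ i) i).coeff r|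
        = |(∏ i, pencil d S (σ i) i).coeff r| := by
      rcases Int.units_eq_one_or (Equiv.Perm.sign σ) with h1 | h1 <;> simp [h1]
    rw [hsgn, coeff_prod_pencil]
    calc |∑ lam : Fin m → Fin K, (if r = ∑ i, d (lam i) then ∏ i, S (lam i) (σ i) i else 0)|
        ≤ ∑ lam : Fin m → Fin K, |if r = ∑ i, d (lam i) then ∏ i, S (lam i) (σ i) i else 0| :=
          Finset.abs_sum_le_sum_abs _ _
      _ ≤ ∑ lam : Fin m → Fin K, (if (∑ i, d (lam i)) = r then h ^ m else 0) := by
          refine Finset.sum_le_sum (fun lam _ => ?_)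
          by_cases hc : (∑ i, d (lam i)) = r
          · rw [if_pos hc.symm, if_pos hc, Finset.abs_prod]
            calc ∏ i, |S (lam i) (σ i) i| ≤ ∏ _i : Fin m, h :=
                  Finset.prod_le_prod (fun i _ => abs_nonneg _) (fun i _ => hS _ _ _)
              _ = h ^ m := by simp
          · rw [if_neg (fun h' => hc h'.symm), if_neg hc, abs_zero]
      _ = h ^ m * Rrep d m r := by
          rw [← Finset.sum_filter, Finset.sum_const, nsmul_eq_mul, mul_comm]
          simp [Rrep]
  calc |∑ σ : Equiv.Perm (Fin m),
          ((((Equiv.Perm.sign σ : ℤˣ) : ℤ) : ℝ[X]) * ∏ i, pencil d S (σ i) i).coeff r|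
      ≤ ∑ σ : Equiv.Perm (Fin m),
          |((((Equiv.Perm.sign σ : ℤˣ) : ℤ) : ℝ[X]) * ∏ i, pencil d S (σ i) i).coeff r| :=
        Finset.abs_sum_le_sum_abs _ _
    _ ≤ ∑ _σ : Equiv.Perm (Fin m), h ^ m * Rrep d m r := Finset.sum_le_sum (fun σ _ => key σ)
    _ = (m.factorial : ℝ) * (h ^ m * Rrep d m r) := by
        rw [Finset.sum_const, Finset.card_univ, Fintype.card_perm, Fintype.card_fin, nsmul_eq_mul]

/-! ## §5 THE PROFILE LAW for full-positive-rooted pencils (PROVED):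
`C(n,r)² · |c₀ · lc| ≤ (m!)² h^{2m} · R(r) · R(n−r)` for every `r ≤ n` -/

/-- **Profile law.**  A pencil with letters `≤ h` whose determinant has `n = natDegree` distinct positive roots obeys,
for every `r ≤ n`, `C(n,r)²·|c₀·lc| ≤ (m!·h^m·R(r))·(m!·h^m·R(n−r))` where `R = R_d^{(m)}` counts ordered `m`-fold
representations by the exponent design.  Summed over `r` (`Σ_r R(r) = K^m`) it returns line «range»'s count law
`2^n √|c₀·lc| ≤ m!(Kh)^m`; its strength is on THIN designs (`R` small: Sidon / `B_m[g]` sets), where it is `K`-FREE. -/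
theorem pencilProfileLaw {m K : ℕ} (d : Fin K → ℕ) (S : Fin K → Matrix (Fin m) (Fin m) ℝ) {h : ℝ}
    (hS : ∀ l i j, |S l i j| ≤ h) (hfull : IsFullPosRooted (pencil d S).det) {r : ℕ}
    (hr : r ≤ (pencil d S).det.natDegree) :
    (((pencil d S).det.natDegree.choose r : ℕ) : ℝ) ^ 2
        * |(pencil d S).det.coeff 0 * (pencil d S).det.leadingCoeff|
      ≤ ((m.factorial : ℝ) * (h ^ m * Rrep d m r))
        * ((m.factorial : ℝ) * (h ^ m * Rrep d m ((pencil d S).det.natDegree - r))) := by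
  have h1 := profileLaw_fullPos _ hfull hr
  rw [abs_mul ((pencil d S).det.coeff r) ((pencil d S).det.coeff _)] at h1
  exact h1.trans (mul_le_mul (abs_coeff_det_pencil_le d S hS r) (abs_coeff_det_pencil_le d S hS _)
    (abs_nonneg _) ((abs_nonneg _).trans (abs_coeff_det_pencil_le d S hS r)))

/-- `K`-FREE COROLLARY (thin designs): on a `B_m`-type design with `R(r)·R(n−r) ≤ g²` at some `r ≤ n`, a full pencil has
`C(n,r)·√|c₀·lc| ≤ m!·h^m·g` — no dependence on the number of letters `K`. -/
theorem profileLaw_thin {m K : ℕ} (d : Fin K → ℕ) (S : Fin K → Matrix (Fin m) (Fin m) ℝ) {h : ℝ}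
    (hS : ∀ l i j, |S l i j| ≤ h) (hfull : IsFullPosRooted (pencil d S).det) {r g : ℕ}
    (hr : r ≤ (pencil d S).det.natDegree)
    (hthin : Rrep d m r * Rrep d m ((pencil d S).det.natDegree - r) ≤ g ^ 2) :
    (((pencil d S).det.natDegree.choose r : ℕ) : ℝ) ^ 2
        * |(pencil d S).det.coeff 0 * (pencil d S).det.leadingCoeff|
      ≤ ((m.factorial : ℝ) * h ^ m * g) ^ 2 := by
  have h1 := pencilProfileLaw d S hS hfull hr
  have h2 : ((Rrep d m r : ℕ) : ℝ) * (Rrep d m ((pencil d S).det.natDegree - r) : ℕ) ≤ (g : ℝ) ^ 2 := by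
    exact_mod_cast hthin
  calc _ ≤ _ := h1
    _ = ((m.factorial : ℝ) * h ^ m) ^ 2
          * (((Rrep d m r : ℕ) : ℝ) * (Rrep d m ((pencil d S).det.natDegree - r) : ℕ)) := by ring
    _ ≤ ((m.factorial : ℝ) * h ^ m) ^ 2 * (g : ℝ) ^ 2 := mul_le_mul_of_nonneg_left h2 (by positivity)
    _ = _ := by ring

/-! ## §6 INSTRUMENT ROWS on the census's extremal stamp bases (PROVED): per-basis integer height thresholds -/

/-- Extremal additive 2-bases of the census (as in «stamp»). -/
def dA5 : Fin 6 → ℕ := ![0, 1, 3, 5, 7, 8]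
def dA6 : Fin 7 → ℕ := ![0, 1, 3, 5, 7, 9, 10]
def dA7a : Fin 8 → ℕ := ![0, 1, 3, 5, 7, 8, 17, 18]
def dA7b : Fin 8 → ℕ := ![0, 1, 3, 4, 9, 10, 12, 13]
def dA7c : Fin 8 → ℕ := ![0, 1, 2, 5, 8, 11, 12, 13]
def dA8a : Fin 9 → ℕ := ![0, 1, 3, 5, 7, 9, 10, 21, 22]
def dA8b : Fin 9 → ℕ := ![0, 1, 2, 5, 8, 11, 14, 15, 16]

/-- Row schema: on design `d`, no full `2×2` pencil with letters `≤ H` and `|c₀·lc| ≥ 1` has degree `n`. -/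
def ProfileRow {K : ℕ} (d : Fin K → ℕ) (H : ℝ) (n : ℕ) : Prop :=
  ∀ S : Fin K → Matrix (Fin 2) (Fin 2) ℝ, (∀ l i j, |S l i j| ≤ H) →
    1 ≤ |(pencil d S).det.coeff 0 * (pencil d S).det.leadingCoeff| →
    IsFullPosRooted (pencil d S).det → (pencil d S).det.natDegree ≠ n

/-- The row follows from one thin window `(r, R(r), R(n−r))` with `C(n,r)² > 16·H⁴·R(r)·R(n−r)`. -/
theorem profileRow_of {K : ℕ} (d : Fin K → ℕ) {H : ℝ} {n r : ℕ} (hr : r ≤ n)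
    (hnum : (2 * (H ^ 2 * Rrep d 2 r)) * (2 * (H ^ 2 * Rrep d 2 (n - r))) < ((n.choose r : ℕ) : ℝ) ^ 2) :
    ProfileRow d H n := by
  intro S hS hends hfull hn
  have key := pencilProfileLaw d S hS hfull (r := r) (by rw [hn]; exact hr)
  rw [hn] at key
  have h1 : ((n.choose r : ℕ) : ℝ) ^ 2 * 1
      ≤ ((n.choose r : ℕ) : ℝ) ^ 2 * |(pencil d S).det.coeff 0 * (pencil d S).det.leadingCoeff| :=
    mul_le_mul_of_nonneg_left hends (by positivity)
  have h2 := h1.trans key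
  norm_num [Nat.factorial] at h2
  linarith


/-! ## §7 The seven rows (PROVED; `Rrep` by `decide`, binomials by `norm_num`) -/

/-- On `dA5`: an integer-normalised full `2×2` pencil of degree `16` has a letter `≥ 54`
(window `r = 7`: `R(7) = 2`, `R(9) = 2`, `C(16,7) = 11440`; line «range» alone gives only the generic `K`-row). -/
theorem profileRow_dA5 : ProfileRow dA5 53 16 := by
  refine profileRow_of dA5 (r := 7) (by norm_num) ?_
  have hsub : (16 : ℕ) - 7 = 9 := rfl
  have h1 : Rrep dA5 2 7 = 2 := by decide
  have h2 : Rrep dA5 2 9 = 2 := by decide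
  have h3 : ((16 : ℕ).choose 7) = 11440 := by
    rw [Nat.choose_eq_factorial_div_factorial (by norm_num)]; norm_num [Nat.factorial]
  rw [hsub, h1]
  try rw [h2]
  rw [h3]
  norm_num

/-- On `dA6`: an integer-normalised full `2×2` pencil of degree `20` has a letter `≥ 205`
(window `r = 9`: `R(9) = 2`, `R(11) = 2`, `C(20,9) = 167960`; line «range» alone gives only the generic `K`-row). -/
theorem profileRow_dA6 : ProfileRow dA6 204 20 := by
  refine profileRow_of dA6 (r := 9) (by norm_num) ?_
  have hsub : (20 : ℕ) - 9 = 11 := rfl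
  have h1 : Rrep dA6 2 9 = 2 := by decide
  have h2 : Rrep dA6 2 11 = 2 := by decide
  have h3 : ((20 : ℕ).choose 9) = 167960 := by
    rw [Nat.choose_eq_factorial_div_factorial (by norm_num)]; norm_num [Nat.factorial]
  rw [hsub, h1]
  try rw [h2]
  rw [h3]
  norm_num

/-- On `dA7a`: an integer-normalised full `2×2` pencil of degree `26` has a letter `≥ 1848`
(window `r = 12`: `R(12) = 2`, `R(14) = 1`, `C(26,12) = 9657700`; line «range» alone gives only the generic `K`-row). -/
theorem profileRow_dA7a : ProfileRow dA7a 1847 26 := by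
  refine profileRow_of dA7a (r := 12) (by norm_num) ?_
  have hsub : (26 : ℕ) - 12 = 14 := rfl
  have h1 : Rrep dA7a 2 12 = 2 := by decide
  have h2 : Rrep dA7a 2 14 = 1 := by decide
  have h3 : ((26 : ℕ).choose 12) = 9657700 := by
    rw [Nat.choose_eq_factorial_div_factorial (by norm_num)]; norm_num [Nat.factorial]
  rw [hsub, h1]
  try rw [h2]
  rw [h3]
  norm_num

/-- On `dA7b`: an integer-normalised full `2×2` pencil of degree `26` has a letter `≥ 1390`
(window `r = 11`: `R(11) = 2`, `R(15) = 2`, `C(26,11) = 7726160`; line «range» alone gives only the generic `K`-row). -/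
theorem profileRow_dA7b : ProfileRow dA7b 1389 26 := by
  refine profileRow_of dA7b (r := 11) (by norm_num) ?_
  have hsub : (26 : ℕ) - 11 = 15 := rfl
  have h1 : Rrep dA7b 2 11 = 2 := by decide
  have h2 : Rrep dA7b 2 15 = 2 := by decide
  have h3 : ((26 : ℕ).choose 11) = 7726160 := by
    rw [Nat.choose_eq_factorial_div_factorial (by norm_num)]; norm_num [Nat.factorial]
  rw [hsub, h1]
  try rw [h2]
  rw [h3]
  norm_num

/-- On `dA7c`: an integer-normalised full `2×2` pencil of degree `26` has a letter `≥ 1390`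
(window `r = 11`: `R(11) = 2`, `R(15) = 2`, `C(26,11) = 7726160`; line «range» alone gives only the generic `K`-row). -/
theorem profileRow_dA7c : ProfileRow dA7c 1389 26 := by
  refine profileRow_of dA7c (r := 11) (by norm_num) ?_
  have hsub : (26 : ℕ) - 11 = 15 := rfl
  have h1 : Rrep dA7c 2 11 = 2 := by decide
  have h2 : Rrep dA7c 2 15 = 2 := by decide
  have h3 : ((26 : ℕ).choose 11) = 7726160 := by
    rw [Nat.choose_eq_factorial_div_factorial (by norm_num)]; norm_num [Nat.factorial]
  rw [hsub, h1]
  try rw [h2]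
  rw [h3]
  norm_num

/-- On `dA8a`: an integer-normalised full `2×2` pencil of degree `32` has a letter `≥ 12259`
(window `r = 16`: `R(16) = 2`, `R(16) = 2`, `C(32,16) = 601080390`; line «range» alone gives only the generic `K`-row). -/
theorem profileRow_dA8a : ProfileRow dA8a 12258 32 := by
  refine profileRow_of dA8a (r := 16) (by norm_num) ?_
  have hsub : (32 : ℕ) - 16 = 16 := rfl
  have h1 : Rrep dA8a 2 16 = 2 := by decide
  have h2 : Rrep dA8a 2 16 = 2 := by decide
  have h3 : ((32 : ℕ).choose 16) = 601080390 := by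
    rw [Nat.choose_eq_factorial_div_factorial (by norm_num)]; norm_num [Nat.factorial]
  rw [hsub, h1]
  try rw [h2]
  rw [h3]
  norm_num

/-- On `dA8b`: an integer-normalised full `2×2` pencil of degree `32` has a letter `≥ 10857`
(window `r = 14`: `R(14) = 2`, `R(18) = 2`, `C(32,14) = 471435600`; line «range» alone gives only the generic `K`-row). -/
theorem profileRow_dA8b : ProfileRow dA8b 10856 32 := by
  refine profileRow_of dA8b (r := 14) (by norm_num) ?_
  have hsub : (32 : ℕ) - 14 = 18 := rfl
  have h1 : Rrep dA8b 2 14 = 2 := by decide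
  have h2 : Rrep dA8b 2 18 = 2 := by decide
  have h3 : ((32 : ℕ).choose 14) = 471435600 := by
    rw [Nat.choose_eq_factorial_div_factorial (by norm_num)]; norm_num [Nat.factorial]
  rw [hsub, h1]
  try rw [h2]
  rw [h3]
  norm_num

/-! ## §8 «Assume the law fails»: violating designs are ADDITIVELY RICH across the whole binomial window (PROVED) -/

/-- If a full-positive-rooted pencil of degree `n` exists on design `d` at height `h` with `|c₀·lc| ≥ 1`, then for every
`r ≤ n` the symmetrised representation number dominates the binomial profile: `C(n,r) ≤ m!·h^m·max(R(r), R(n−r))`.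
So a long full format at bounded height forces `max_r R ≥ C(n,⌊n/2⌋)/(m! h^m)` — high additive energy of the design —
whereas Sidon / `B_m[g]` designs (`R ≤ g·m!`) carry only `n ≤ log-height` full formats, uniformly in `K`. -/
theorem design_rich_of_full {m K : ℕ} (d : Fin K → ℕ) (S : Fin K → Matrix (Fin m) (Fin m) ℝ) {h : ℝ} (hh : 0 ≤ h)
    (hS : ∀ l i j, |S l i j| ≤ h) (hends : 1 ≤ |(pencil d S).det.coeff 0 * (pencil d S).det.leadingCoeff|)
    (hfull : IsFullPosRooted (pencil d S).det) {r : ℕ} (hr : r ≤ (pencil d S).det.natDegree) :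
    (((pencil d S).det.natDegree.choose r : ℕ) : ℝ)
      ≤ (m.factorial : ℝ) * h ^ m
        * max (Rrep d m r : ℝ) (Rrep d m ((pencil d S).det.natDegree - r) : ℝ) := by
  set M := max (Rrep d m r : ℝ) (Rrep d m ((pencil d S).det.natDegree - r) : ℝ) with hM
  have key := pencilProfileLaw d S hS hfull hr
  have hA : 0 ≤ (m.factorial : ℝ) * h ^ m := by positivity
  have h1 : (((pencil d S).det.natDegree.choose r : ℕ) : ℝ) ^ 2 ≤ ((m.factorial : ℝ) * h ^ m * M) ^ 2 := by
    have hR1 : (Rrep d m r : ℝ) ≤ M := le_max_left _ _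
    have hR2 : (Rrep d m ((pencil d S).det.natDegree - r) : ℝ) ≤ M := le_max_right _ _
    calc (((pencil d S).det.natDegree.choose r : ℕ) : ℝ) ^ 2
        = (((pencil d S).det.natDegree.choose r : ℕ) : ℝ) ^ 2 * 1 := by ring
      _ ≤ (((pencil d S).det.natDegree.choose r : ℕ) : ℝ) ^ 2
            * |(pencil d S).det.coeff 0 * (pencil d S).det.leadingCoeff| :=
          mul_le_mul_of_nonneg_left hends (by positivity)
      _ ≤ _ := key
      _ ≤ ((m.factorial : ℝ) * (h ^ m * M)) * ((m.factorial : ℝ) * (h ^ m * M)) :=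
          mul_le_mul (mul_le_mul_of_nonneg_left (mul_le_mul_of_nonneg_left hR1 (by positivity)) (by positivity))
            (mul_le_mul_of_nonneg_left (mul_le_mul_of_nonneg_left hR2 (by positivity)) (by positivity))
            (by positivity) (by positivity)
      _ = ((m.factorial : ℝ) * h ^ m * M) ^ 2 := by ring
  have hMnn : 0 ≤ (m.factorial : ℝ) * h ^ m * M := mul_nonneg hA ((Nat.cast_nonneg _).trans (le_max_left _ _))
  exact (pow_le_pow_iff_left₀ (Nat.cast_nonneg _) hMnn two_ne_zero).1 h1


end Summit.ValiantsHypothesis.ValiantsHypothesis.Theses.LacunarySymmetroid.ProfileLine
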